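import Summits.AnomalousDissipation.AnomalousDissipation.Theorems.SolenoidalFractalHomogenisationLagrangianCarrierAnalyticTower
import Literature.Analysis.FunctionSpaces.TorusCubeJackson
import HarnessLib

/-!
# W3-E (ii): prefactor-free CUBE TAILS of the coarse field `b_{≤m}` of a Lagrangian lattice carrier
# (helper for K1L_D `stmt-AnomalousDissipation-27980`, `stub_effectiveFrameEnergyL_bandKill`; input (I) of the band-kill ladder)

Summits-side helper file (everything proved; no definitions, no named facts).  Jackson on the cube (`…TorusCubeJackson`,
`exists_realTrigPoly_cubeSupp_near_of_dnorm_le`) applied LEVEL BY LEVEL to the analytic tower (`…LagrangianCarrierAnalyticTower`,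
`analytic_tower_vec`: `⟦b (i+1) t⟧_{n, ρ_* N_{i+1}} ≤ C_b a_{i+1}/N_{i+1}`) and summed: for every time `t`, every coarse level count `m` and
every cube parameter `Q ≥ 2` there is a conjugate-symmetric coefficient family `c` on the cube `‖k‖_∞ ≤ Q` with
`‖b_{≤m}(t, x) − realTrigPoly (cubeSupp Q) c x‖ ≤ Σ_{i<m} 66 C_b (a_{i+1}/N_{i+1}) exp(−((Q−1)/2)/(4e·21³ ρ_* N_{i+1}))`
for all `x` (`partialSum_cube_tail`) — the spectral tail of the carrier in the best-approximation currency of F-k3l-8, with NO power of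
`Q` or `N` in front (each level decays at its own radius).  §1 is the generic summation of Jackson approximants.
Infrastructure for route-1's rung leaf F-D1.A0 (a frontier FORMAL rung); NOT a proof of anomalous dissipation.
-/

set_option linter.dupNamespace false

noncomputable section

namespace Summit.AnomalousDissipation.AnomalousDissipation.Theorems.SolenoidalFractalHomogenisation.LagrangianCarrierAnalytic

open Set Function Filter Topology
open Literature.Analysis Literature.Analysis.FunctionSpaces Literature.Analysis.FunctionSpaces.Torus
open Literature.Analysis.FluidPDE Literature.Analysis.FluidPDE.LatticeShear

variable {k : ℕ}

/-! ## §1 Jackson for finite sums of analytic fields -/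

/-- **Jackson on the cube for a finite sum**, each summand at its own radius: if `⟦g i⟧_{n, R i} ≤ M i` for all `n` and `i < m`, then for
`0 < Δ'`, `K ≤ Δ'` there is a conjugate-symmetric `c` with `‖Σ_{i<m} g i x − realTrigPoly (cubeSupp (K + 2Δ')) c x‖ ≤
Σ_{i<m} 66 M i exp(−Δ'/(4e·21³ R i))` (`24e < 66`). [cite: DeVoreLorentz1993, Ch. 7 §2; ArmstrongVicol2025, App. A (A.1)] -/
theorem exists_realTrigPoly_cubeSupp_near_sum (m : ℕ) {g : ℕ → UnitAddTorus (Fin 3) → EuclideanSpace ℝ (Fin 3)}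
    (hg : ∀ i, i < m → IsSmooth (g i)) {R M : ℕ → ℝ} (hR : ∀ i, 0 < R i) (hM : ∀ i, 0 < M i)
    (hdn : ∀ i, i < m → ∀ n, dnorm n (R i) (g i) ≤ M i) {K Δ' : ℕ} (hΔ' : 0 < Δ') (hK : K ≤ Δ') :
    ∃ c : (Fin 3 → ℤ) → EuclideanSpace ℂ (Fin 3), IsConjSymm c ∧
      ∀ x, ‖(∑ i ∈ Finset.range m, g i x) - realTrigPoly (cubeSupp (Fin 3) (K + 2 * Δ')) c x‖ ≤
        ∑ i ∈ Finset.range m, 66 * M i * Real.exp (-((Δ' : ℝ) / (4 * Real.exp 1 * 21 ^ 3 * R i))) := by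
  induction m with
  | zero =>
    refine ⟨0, isConjSymm_zero, fun x => ?_⟩
    simp
  | succ m ih =>
    obtain ⟨c, hc, hcx⟩ := ih (fun i hi => hg i (Nat.lt_succ_of_lt hi)) (fun i hi => hdn i (Nat.lt_succ_of_lt hi))
    have he : Real.exp 1 < 2.75 := lt_trans Real.exp_one_lt_d9 (by norm_num)
    have hWlt : (Fintype.card (Fin 3) : ℝ) * 2 ^ Fintype.card (Fin 3) * Real.exp 1 * M m *
        Real.exp (-((Δ' : ℝ) / (4 * Real.exp 1 * 21 ^ Fintype.card (Fin 3) * R m))) <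
        66 * M m * Real.exp (-((Δ' : ℝ) / (4 * Real.exp 1 * 21 ^ 3 * R m))) := by
      rw [Fintype.card_fin]
      have hex : 0 < Real.exp (-((Δ' : ℝ) / (4 * Real.exp 1 * 21 ^ 3 * R m))) := Real.exp_pos _
      have hMe : 0 < M m * Real.exp (-((Δ' : ℝ) / (4 * Real.exp 1 * 21 ^ 3 * R m))) := mul_pos (hM m) hex
      nlinarith
    obtain ⟨c', hc', hcx'⟩ := exists_realTrigPoly_cubeSupp_near_of_dnorm_le hΔ' hK (hg m (Nat.lt_succ_self m)) (hR m) (hM m).le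
      (hdn m (Nat.lt_succ_self m)) hWlt
    refine ⟨c + c', hc.add hc', fun x => ?_⟩
    rw [Finset.sum_range_succ, Finset.sum_range_succ, realTrigPoly_add, Pi.add_apply]
    calc ‖(∑ i ∈ Finset.range m, g i x) + g m x -
          (realTrigPoly (cubeSupp (Fin 3) (K + 2 * Δ')) c x + realTrigPoly (cubeSupp (Fin 3) (K + 2 * Δ')) c' x)‖
        = ‖((∑ i ∈ Finset.range m, g i x) - realTrigPoly (cubeSupp (Fin 3) (K + 2 * Δ')) c x) +
            (g m x - realTrigPoly (cubeSupp (Fin 3) (K + 2 * Δ')) c' x)‖ := by congr 1; abel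
      _ ≤ ‖(∑ i ∈ Finset.range m, g i x) - realTrigPoly (cubeSupp (Fin 3) (K + 2 * Δ')) c x‖ +
            ‖g m x - realTrigPoly (cubeSupp (Fin 3) (K + 2 * Δ')) c' x‖ := norm_add_le _ _
      _ ≤ _ := add_le_add (hcx x) (hcx' x)

/-! ## §2 The coarse field of the carrier -/

/-- **CUBE TAILS OF `b_{≤m}`.**  With the constants `ρ_*, C_b, θ_H` of `analytic_tower_vec`: for every admissible carrier `E`, every `m`,
`t` and every `Q ≥ 2` there is a conjugate-symmetric `c` on the cube `‖k‖_∞ ≤ Q` with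
`‖b_{≤m}(t,x) − realTrigPoly (cubeSupp Q) c x‖ ≤ Σ_{i<m} 66 C_b (a_{i+1}/N_{i+1}) exp(−((Q−1)/2)/(4e·21³ ρ_* N_{i+1}))`.
[cite: ArmstrongVicol2025, App. A (A.1) and §2.2 (PDF p. 18); DeVoreLorentz1993, Ch. 7 §2] -/
theorem partialSum_cube_tail (k : ℕ) (W : LatticeWord k) (M : ℝ) (hM : 0 < M) :
    ∃ ρs : ℝ, 0 < ρs ∧ ∃ Cb : ℝ, 0 < Cb ∧ ∃ θH : ℝ, 0 < θH ∧
      ∀ E : LagrangianLatticeCarrier k, E.design = W.stretch M hM → E.LPermissible → E.Regular →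
        (∀ i, E.θ (i + 1) ≤ θH) → (∀ m, E.N m ^ 2 ≤ E.N (m + 1)) →
        (∀ (i : ℕ) (t : ℝ) (n : ℕ), dnorm n (ρs * E.N (i + 1)) (E.b (i + 1) t) ≤ Cb * (E.a (i + 1) / E.N (i + 1))) ∧
        ∀ (m : ℕ) (t : ℝ) (Q : ℕ), 2 ≤ Q →
          ∃ c : (Fin 3 → ℤ) → EuclideanSpace ℂ (Fin 3), IsConjSymm c ∧
            ∀ x, ‖E.partialSum m t x - realTrigPoly (cubeSupp (Fin 3) Q) c x‖ ≤
              ∑ i ∈ Finset.range m, 66 * (Cb * (E.a (i + 1) / E.N (i + 1))) *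
                Real.exp (-((((Q : ℝ) - 1) / 2) / (4 * Real.exp 1 * 21 ^ 3 * (ρs * E.N (i + 1))))) := by
  obtain ⟨ρs, hρs, Cb, hCb, θH, hθH, h⟩ := analytic_tower_vec k W M hM
  refine ⟨ρs, hρs, Cb, hCb, θH, hθH, fun E hdes hLP hReg hθ hsq => ⟨h E hdes hLP hReg hθ hsq, fun m t Q hQ => ?_⟩⟩
  have hN : ∀ i, (0 : ℝ) < E.N i := fun i => by exact_mod_cast E.N_pos i
  have hR : E.LevelRegular := hReg.levelRegular
  -- `Q = K + 2Δ'` with `K = Q % 2 ≤ 1 ≤ Δ' = Q / 2`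
  have hQ2 : Q % 2 + 2 * (Q / 2) = Q := Nat.mod_add_div Q 2
  have hΔ' : 0 < Q / 2 := Nat.div_pos hQ two_pos
  have hK : Q % 2 ≤ Q / 2 := (Nat.lt_succ_iff.mp (Nat.mod_lt Q two_pos)).trans hΔ'
  obtain ⟨c, hc, hcx⟩ := exists_realTrigPoly_cubeSupp_near_sum m (g := fun i => E.b (i + 1) t)
    (fun i _ => hR.isSmooth_b i t) (R := fun i => ρs * E.N (i + 1)) (M := fun i => Cb * (E.a (i + 1) / E.N (i + 1)))
    (fun i => mul_pos hρs (hN _)) (fun i => mul_pos hCb (div_pos (E.a_pos _) (hN _)))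
    (fun i _ n => h E hdes hLP hReg hθ hsq i t n) hΔ' hK
  rw [hQ2] at hcx
  refine ⟨c, hc, fun x => (le_of_eq ?_).trans ((hcx x).trans (Finset.sum_le_sum fun i _ => ?_))⟩
  · rfl
  · refine mul_le_mul_of_nonneg_left (Real.exp_le_exp.2 (neg_le_neg (div_le_div_of_nonneg_right ?_ (by positivity)))) (by
      have := E.a_pos (i + 1); positivity)
    -- `(Q − 1)/2 ≤ Q / 2` (integer division)
    have h1 : ((Q : ℝ) - 1) / 2 ≤ ((Q / 2 : ℕ) : ℝ) := by
      have h2 : (Q : ℝ) = (Q % 2 : ℕ) + 2 * ((Q / 2 : ℕ) : ℝ) := by exact_mod_cast hQ2.symm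
      have h3 : ((Q % 2 : ℕ) : ℝ) ≤ 1 := by exact_mod_cast Nat.lt_succ_iff.mp (Nat.mod_lt Q two_pos)
      rw [h2]; linarith
    exact h1

end Summit.AnomalousDissipation.AnomalousDissipation.Theorems.SolenoidalFractalHomogenisation.LagrangianCarrierAnalytic

end
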